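import Literature.AnabelianGeometry.EtaleTheta.SettingModelTateInversionAut
import Literature.AnabelianGeometry.EtaleTheta.SettingModelTateInversionXuu
import Literature.AnabelianGeometry.EtaleTheta.SettingModelTateZClass
import Literature.AnabelianGeometry.EtaleTheta.SettingModelChiInvClauses
import Literature.AnabelianGeometry.EtaleTheta.SettingModelHasThetaTopology
import Literature.AnabelianGeometry.EtaleTheta.Discharge.Sec2RigidityAtModelTate
import HarnessLib

/-!
# The STAGE-2 model: the inversion FIXES the theta class of record `η̈♯ = etaDdχq` for every theta companion
# (`ι_* η̈^Θ = η̈^Θ`, GAP row G-L2t2-1 `hιη` at the second constructor site; proof-only)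

Mochizuki, *The étale theta function …*, Publ. RIMS **45** (2009) [EtTh], Prop. 1.4 (ii) p. 22, Thm. 1.6 (iii) p. 24
(«the isomorphism of cohomology groups induced by γ»), Prop. 1.5 (iii) p. 23 [cite: MochizukiEtTh2009, Thm 1.6 (iii) p.24].
abc-iut cell, layer L2, prover abc-iut-L2-d1 (gen 5); PROOF-ONLY stage-2 twin of this seat's `SettingModelChiInversionTheta`
/ `SettingModelChiInvClauses` (clause «`ι` fixes `η̈^Θ`»), over: abc-iut-L2-t5's `ThetaSetting.modelχq p i j hj`;
abc-iut-w5-d249's cocycle-corrected inversion `inversionχq p i j` and this seat's `isInversionAut_inversionχq`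
(`SettingModelTateInversionAut`); abc-iut-L2-t6's class of record `etaDdχq := infl (zClassYddχq)` with its cocycle
`zPartχq h = h · θ⟨b^{ŷ(h)}, aug^Θ h⟩⁻¹` (`SettingModelTateZClass`); abc-iut-L2-t1's `IsInversionAut.thetaIso_apply_eq_self`
(`ι^Θ = id` on `Δ_Θ` for EVERY companion); abc-iut-f-149's `compat_modelχq`.

The computation (`zPartχq_toTheta_inversionχq`): `ŷ(ι g) = ŷ(g)⁻¹ · d(σ)` (`ê_b ∘ σ̂ = inv`, `ê_b(b^d) = d`), so the
representative of the `z`-part of `θ(ι g)` is `inl((ι g).left · b^{−ŷ(ι g)}) = inl(ι_Γ(g.left · b^{−ŷ(g)}))` — the defect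
`b^{d(σ)}` CANCELS — and `ι_Γ` fixes the levels `(0, 0, z)` of `g.left · b^{−ŷ(g)}` (`g ∈ Π^tp_Y`); hence
`zPartχq(θ(ι g)) = zPartχq(θ g)`, the transport `ι^Θ ∘ f ∘ ι⁻¹` of the inflated `z`-cocycle IS the cocycle
(`transportFun_zFunχq_inversionχq`), **`transport_etaDdχq (cι) : ι_* η̈♯ = η̈♯`** for every companion `cι`, and
**`hιη_modelχq`**: GAP row G-L2t2-1 holds at the stage-2 model with `τ := 1 ∈ Π^tp_X̲̲ = Huuχq` (and a companion
EXISTS: `thetaCompanionOfAut`, `exists_thetaCompanion_inversionχq`).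
SEMI-SYNTHETIC MODEL, consistency evidence only; nothing of [EtTh] asserted; no side taken on [IUTchIII] Cor. 3.12.
-/

noncomputable section

namespace Literature.AnabelianGeometry.EtaleTheta.SettingModel

open Literature.AnabelianGeometry.SemiGraphs _root_.Function

variable (p : ℕ) [Fact p.Prime] (i j : ℤ) (hj : Even j)
  (cι : ThetaSetting.ThetaCompanion (Dα := ThetaSetting.modelχq p i j hj) (Dβ := ThetaSetting.modelχq p i j hj)
    (inversionχq p i j))

/-! ### `ι⁻¹ = ι`, `ι^Θ = id` on `Δ_Θ` -/

/-- The inverse of the (involutive) stage-2 inversion is itself. [cite: MochizukiEtTh2009, §2 p.36] -/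
theorem inversionχq_symm_apply (x : PiTpχq p i j) : (inversionχq p i j).symm x = inversionχq p i j x := by
  apply (inversionχq p i j).injective
  rw [ContinuousMulEquiv.apply_symm_apply, inversionχq_inversionχq]

/-- `ι^Θ(a) = a` for `a ∈ Δ_Θ`, for EVERY theta companion of the stage-2 inversion (abc-iut-L2-t1's
`IsInversionAut.thetaIso_apply_eq_self`). [cite: MochizukiEtTh2009, Prop 1.5 (iii) p.23] -/
theorem thetaIso_inversionχq_apply_eq_self {a : (ThetaSetting.modelχq p i j hj).GtpTheta}
    (ha : a ∈ (ThetaSetting.modelχq p i j hj).DeltaTheta) : cι.thetaIso a = a :=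
  (isInversionAut_inversionχq p i j hj).thetaIso_apply_eq_self cι ha

/-! ### The `z`-part is `ι`-invariant -/

/-- **`ŷ(ι g) = ŷ(g)⁻¹ · d(σ)`**: the `y`-coordinate of `(ι g).left = ι_Γ(g.left) · b^{d(σ)}`, `d(σ) = κ_p(σ)^{j−2i}`
(`ê_b ∘ σ̂ = inv`, `ê_b(b^d) = d`). [cite: MochizukiEtTh2009, Prop 2.2 (i) p.37] -/
theorem yCoordχq_inversionχq (g : PiTpχq p i j) :
    yCoordχq p i j (inversionχq p i j g) = (yCoordχq p i j g)⁻¹ * invDefect (tatePairHom p i j g.right) := by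
  rw [yCoordχq_apply, yCoordχq_apply, inversionχq_apply, tateInversion_left, map_mul, map_mul, gfpFst_bPowGfp,
    eHatB_bPow]
  exact congrArg (· * _) (eHatB_sigmaHat (gfpFst g.left))

/-- **The defect cancels in the `z`-part representative**: `(ι g).left · b^{−ŷ(ι g)} = ι_Γ(g.left · b^{−ŷ(g)})`.
[cite: MochizukiEtTh2009, Prop 1.5 p.23] -/
theorem left_inversionχq_mul_bPowGfp_inv (g : PiTpχq p i j) :
    (inversionχq p i j g).left * (bPowGfp (yCoordχq p i j (inversionχq p i j g)))⁻¹ =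
      gfpInv (g.left * (bPowGfp (yCoordχq p i j g))⁻¹) := by
  rw [yCoordχq_inversionχq, inversionχq_apply, tateInversion_left, map_mul gfpInv, map_inv gfpInv, gfpInv_bPowGfp,
    inv_inv, map_mul bPowGfp, map_inv bPowGfp, mul_inv_rev, inv_inv, mul_assoc, mul_inv_cancel_left]

/-- The representative `inl(g.left · b^{−ŷ(g)})` of the `z`-part of `θ(g)` lies in `Ker(Π^tp_X ↠ (Π^tp_X)^ell)` for
`g ∈ Π^tp_Y` (abc-iut-L2-t6's `zPartχq_mem_deltaTheta`, unfolded). [cite: MochizukiEtTh2009, Prop 1.5 p.23] -/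
theorem inl_left_mul_bPowGfp_inv_mem_ellKer {g : PiTpχq p i j} (hgY : g ∈ (ThetaSetting.modelχq p i j hj).GtpY) :
    (SemidirectProduct.inl (g.left * (bPowGfp (yCoordχq p i j g))⁻¹) : PiTpχq p i j) ∈
      CurveTheta.ellKer (curveχq p i j) := by
  rw [← CurveTheta.mk_mem_ker_thetaToEll_iff, ← mul_refReprχq_inv_eq_inl, map_mul, map_inv]
  exact zPartχq_mem_deltaTheta p i j hj ⟨g, hgY, rfl⟩

/-- **`zPartχq(θ(ι g)) = zPartχq(θ g)` for `g ∈ Π^tp_Y`**: the defect cancels and `ι_Γ` fixes the levels `(0, 0, z)`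
of `g.left · b^{−ŷ(g)}`. [cite: MochizukiEtTh2009, Thm 1.6 (iii) p.24] -/
theorem zPartχq_toTheta_inversionχq {g : PiTpχq p i j} (hgY : g ∈ (ThetaSetting.modelχq p i j hj).GtpY) :
    zPartχq p i j ((ThetaSetting.modelχq p i j hj).toTheta (inversionχq p i j g)) =
      zPartχq p i j ((ThetaSetting.modelχq p i j hj).toTheta g) := by
  rw [zPartχq_def, zPartχq_def, refLiftχq_def, refLiftχq_def]
  change CurveTheta.toTheta (curveχq p i j) (inversionχq p i j g) *
      (CurveTheta.toTheta (curveχq p i j) (refReprχq p i j (CurveTheta.toTheta (curveχq p i j) (inversionχq p i j g))))⁻¹ =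
    CurveTheta.toTheta (curveχq p i j) g *
      (CurveTheta.toTheta (curveχq p i j) (refReprχq p i j (CurveTheta.toTheta (curveχq p i j) g)))⁻¹
  rw [← map_inv, ← map_mul, ← map_inv, ← map_mul, mul_refReprχq_inv_eq_inl, mul_refReprχq_inv_eq_inl,
    left_inversionχq_mul_bPowGfp_inv]
  obtain ⟨hxy, -⟩ := (mem_ellKerχq_iff p i j _).mp (inl_left_mul_bPowGfp_inv_mem_ellKer p i j hj hgY)
  refine toThetaq_eq_of_right_eq_one p i j _ _ (SemidirectProduct.right_inl _) (SemidirectProduct.right_inl _) ?_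
  rw [mem_closure_commutator₃_iff_forall_hHat]
  intro N
  obtain ⟨hx, hy⟩ := hxy N
  rw [SemidirectProduct.left_inl] at hx hy
  rw [SemidirectProduct.left_inl, SemidirectProduct.left_inl, map_mul, map_inv]
  change levelHom N (gfpInv (g.left * (bPowGfp (yCoordχq p i j g))⁻¹)) *
      (levelHom N (g.left * (bPowGfp (yCoordχq p i j g))⁻¹))⁻¹ = 1
  rw [levelHom_gfpInv, mul_inv_eq_one]
  change Heis.negXY (hHat N (gfpFst (g.left * (bPowGfp (yCoordχq p i j g))⁻¹))) =
    hHat N (gfpFst (g.left * (bPowGfp (yCoordχq p i j g))⁻¹))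
  ext
  · rw [Heis.negXY_x, hx, neg_zero]
  · rw [Heis.negXY_y, hy, neg_zero]
  · rw [Heis.negXY_z]

/-! ### The transport fixes `η̈♯` -/

/-- `η̈♯ = etaDdχq` as the class of an explicit cocycle on `Π^tp_Ÿ`: `x ↦ zPartχq(θ x)` (inflation of abc-iut-L2-t6's
`zFunχq`), by `rfl`. [cite: MochizukiEtTh2009, Prop 1.5 (iii) p.23] -/
theorem etaDdχq_eq_mk :
    etaDdχq p i j hj =
      ContH1.mk
        (fun x : ↥(ThetaSetting.modelχq p i j hj).GtpYdd =>
          zFunχq p i j hj _ (Subgroup.map_mono (ThetaSetting.modelχq p i j hj).GtpYdd_le_GtpY)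
            ⟨(ThetaSetting.modelχq p i j hj).toTheta (x : PiTpχq p i j), ⟨x.1, x.2, rfl⟩⟩)
        (ContH1.inflCocycle (ThetaSetting.modelχq p i j hj).DeltaTheta (ThetaSetting.modelχq p i j hj).toTheta
          (ThetaSetting.modelχq p i j hj).continuous_toTheta le_rfl
          ⟨zFunχq p i j hj _ (Subgroup.map_mono (ThetaSetting.modelχq p i j hj).GtpYdd_le_GtpY),
            zFunχq_mem p i j hj _ (Subgroup.map_mono (ThetaSetting.modelχq p i j hj).GtpYdd_le_GtpY)⟩).2 :=
  rfl

/-- **The transport `ι^Θ ∘ f ∘ ι⁻¹` (Thm. 1.6 (iii)) of the inflated `z`-cocycle along the stage-2 inversion IS the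
cocycle**, for every companion `ι^Θ`. [cite: MochizukiEtTh2009, Thm 1.6 (iii) p.24] -/
theorem transportFun_zFunχq_inversionχq :
    ThetaSetting.transportFun cι (isInversionAut_inversionχq p i j hj).thm16i
        (fun x : ↥(ThetaSetting.modelχq p i j hj).GtpYdd =>
          zFunχq p i j hj _ (Subgroup.map_mono (ThetaSetting.modelχq p i j hj).GtpYdd_le_GtpY)
            ⟨(ThetaSetting.modelχq p i j hj).toTheta (x : PiTpχq p i j), ⟨x.1, x.2, rfl⟩⟩) =
      fun x : ↥(ThetaSetting.modelχq p i j hj).GtpYdd =>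
        zFunχq p i j hj _ (Subgroup.map_mono (ThetaSetting.modelχq p i j hj).GtpYdd_le_GtpY)
          ⟨(ThetaSetting.modelχq p i j hj).toTheta (x : PiTpχq p i j), ⟨x.1, x.2, rfl⟩⟩ := by
  funext x
  apply Subtype.ext
  change cι.thetaIso (zFunχq p i j hj _ (Subgroup.map_mono (ThetaSetting.modelχq p i j hj).GtpYdd_le_GtpY)
      ⟨(ThetaSetting.modelχq p i j hj).toTheta ((inversionχq p i j).toMulEquiv.symm (x : PiTpχq p i j)), _⟩).1 =
    (zFunχq p i j hj _ (Subgroup.map_mono (ThetaSetting.modelχq p i j hj).GtpYdd_le_GtpY)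
      ⟨(ThetaSetting.modelχq p i j hj).toTheta (x : PiTpχq p i j), _⟩).1
  rw [thetaIso_inversionχq_apply_eq_self p i j hj cι (zFunχq p i j hj _ _ _).2, coe_zFunχq, coe_zFunχq]
  change zPartχq p i j ((ThetaSetting.modelχq p i j hj).toTheta ((inversionχq p i j).symm (x : PiTpχq p i j))) =
    zPartχq p i j ((ThetaSetting.modelχq p i j hj).toTheta (x : PiTpχq p i j))
  rw [inversionχq_symm_apply]
  exact zPartχq_toTheta_inversionχq p i j hj ((ThetaSetting.modelχq p i j hj).GtpYdd_le_GtpY x.2)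

/-- **`ι_* η̈♯ = η̈♯` at the stage-2 model**: the transport (Thm. 1.6 (iii)) along the cocycle-corrected inversion and ANY of
its theta companions fixes abc-iut-L2-t6's class of record `etaDdχq`. [cite: MochizukiEtTh2009, Thm 1.6 (iii) p.24] -/
theorem transport_etaDdχq :
    ThetaSetting.transport cι (isInversionAut_inversionχq p i j hj).thm16i (etaDdχq p i j hj) = etaDdχq p i j hj := by
  rw [etaDdχq_eq_mk]
  change ContH1.mk (ThetaSetting.transportFun _ _ _) _ = ContH1.mk _ _
  congr 1
  exact transportFun_zFunχq_inversionχq p i j hj cι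

/-! ### GAP row G-L2t2-1 (`hιη`) at the stage-2 model -/

/-- **`hιη` HOLDS at the stage-2 model for the class of record**, with `τ := 1 ∈ Π^tp_X̲̲ = Huuχq`: for every odd `l` and
every theta companion, the inversion carries `η̈♯` to the (trivial) `Π^tp_X̲̲`-conjugate of itself (`hC := compat_modelχq`).
[cite: MochizukiEtTh2009, Prop 1.4 (ii) p.22] -/
theorem hιη_modelχq (l : ℕ+) (hl : Odd (l : ℕ)) :
    haveI := (compat_modelχq p i j hj).GtpYdd_normal
    ∃ τ ∈ Huuχq p i j l hl, ThetaSetting.transport cι (isInversionAut_inversionχq p i j hj).thm16i (etaDdχq p i j hj) =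
      ContH1.conj (ThetaSetting.modelχq p i j hj).toTheta (ThetaSetting.modelχq p i j hj).DeltaTheta τ (etaDdχq p i j hj) := by
  haveI := (compat_modelχq p i j hj).GtpYdd_normal
  refine ⟨1, Subgroup.one_mem _, ?_⟩
  rw [transport_etaDdχq, ContH1.conj_eq_self_of_mem _ (Subgroup.one_mem _)]

/-- The same for ANY étale-theta datum `E` over the stage-2 model carrying the class of record (`E.etaDd = etaDdχq`).
[cite: MochizukiEtTh2009, Prop 1.4 (ii) p.22] -/
theorem hιη_of_etaDd_eq_etaDdχq (l : ℕ+) (hl : Odd (l : ℕ)) (E : (ThetaSetting.modelχq p i j hj).EtaleThetaData)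
    (hE : E.etaDd = etaDdχq p i j hj) :
    haveI := (compat_modelχq p i j hj).GtpYdd_normal
    ∃ τ ∈ Huuχq p i j l hl, ThetaSetting.transport cι (isInversionAut_inversionχq p i j hj).thm16i E.etaDd =
      ContH1.conj (ThetaSetting.modelχq p i j hj).toTheta (ThetaSetting.modelχq p i j hj).DeltaTheta τ E.etaDd := by
  rw [hE]
  exact hιη_modelχq p i j hj cι l hl

/-! ### A theta companion of the stage-2 inversion exists -/

/-- **A theta companion `ι^Θ` of the stage-2 inversion EXISTS** (abc-iut's `thetaCompanionOfAut`: `ι(Δ^tp_X) = Δ^tp_X` by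
`IsInversionAut.map_deltaTemp`, `toTheta` a quotient map by abc-iut-L2-t5/w5-d111's `hasThetaTopology_modelχq`), so
the statements above are not vacuous in `cι`. [cite: MochizukiEtTh2009, Thm 1.6 (ii) p.24] -/
theorem nonempty_thetaCompanion_inversionχq :
    Nonempty (ThetaSetting.ThetaCompanion (Dα := ThetaSetting.modelχq p i j hj) (Dβ := ThetaSetting.modelχq p i j hj)
      (inversionχq p i j)) :=
  ⟨(ThetaSetting.modelχq p i j hj).thetaCompanionOfAut (inversionχq p i j)
    (isInversionAut_inversionχq p i j hj).map_deltaTemp (hasThetaTopology_modelχq p i j hj).isQuotientMap_toTheta⟩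

/-- **Census form (stage 2)**: at the stage-2 model there are an inversion automorphism (Prop. 1.5 (iii)) and a theta
companion of it whose transport FIXES the class of record `η̈♯ = etaDdχq`, which is carried by `Π^tp_X̲̲ = Huuχq`-conjugation
with `τ = 1`; and `ι(Π^tp_X̲̲) = Π^tp_X̲̲` (this seat's `map_Huuχq_inversionχq`). [cite: MochizukiEtTh2009, Thm 1.6 (iii) p.24] -/
theorem exists_isInversionAut_transport_etaDdχq (l : ℕ+) (hl : Odd (l : ℕ)) :
    ∃ (ι : (ThetaSetting.modelχq p i j hj).PiTemp ≃ₜ* (ThetaSetting.modelχq p i j hj).PiTemp)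
      (hι : (ThetaSetting.modelχq p i j hj).IsInversionAut ι) (c : ThetaSetting.ThetaCompanion ι),
      ThetaSetting.transport c hι.thm16i (etaDdχq p i j hj) = etaDdχq p i j hj ∧
        (Huuχq p i j l hl).map ι.toMulEquiv.toMonoidHom = Huuχq p i j l hl :=
  ⟨inversionχq p i j, isInversionAut_inversionχq p i j hj, (nonempty_thetaCompanion_inversionχq p i j hj).some,
    transport_etaDdχq p i j hj _, map_Huuχq_inversionχq p i j l hl⟩

end Literature.AnabelianGeometry.EtaleTheta.SettingModel

end
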